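import Literature.AnabelianGeometry.SemiGraphs.MetabelianLeafStarEscapeSelfMaximal
import Literature.AnabelianGeometry.SemiGraphs.MetabelianLeafStarAnchored
import Literature.AnabelianGeometry.SemiGraphs.TemperedQuasiGeometric
import Literature.AnabelianGeometry.SemiGraphs.TemperedVerticialNamedFactsProofs
import HarnessLib

/-!
# Tools for the (a)-SOURCE quadrant of [SemiAnbd] Cor. 3.9 at the rayless star `𝒢⋆(p)`: the scaling
# endomorphisms of the leaves, tail-trivial homomorphisms conjugate the escaping element into a vertex group,
# and an anchored image of `⟨c⟩‾` kills quasi-geometricity («COR39-UPTOTWIST@RAYLESS-STAR (a)-source», file 1)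

Mochizuki, *Semi-graphs of anabelioids*, Publ. RIMS **42** (2006), §3: Def. 3.8 (quasi-geometric morphisms)
and Cor. 3.9 with its proof, manuscript pp. 42–43; Prop. 3.6 (iv) p. 39; Thm. 3.7 (iv) p. 41
[cite: MochizukiSemiAnbd2006, Cor 3.9 pp.42-43].

PROOF-ONLY file (no definition, no named fact; abc-iut cell, layer L3, row «COR39-UPTOTWIST@RAYLESS-STAR
(a)-source quadrant» (L3-lead gen 8 δ22 (1)), seat abc-iut-L3-t8 gen 8).  At the canonical chart of
`𝒢⋆(p) = metabelianLeafStar p` with its escaping element `c = lim_k h_k·ψ₀(a)·h_k⁻¹` (`exists_escapeLimit`;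
`C₀ := ⟨c⟩‾` an ABELIAN exotic maximal compact subgroup, gen 7 B2):

* `Iw.exists_leafScaling` — the SCALING endomorphism `(z, u) ↦ (p^k·z, u)` of the leaf group
  `Leaf n = ℤ_p ⋊ ⟨1 + p^{n+1}⟩‾` is a continuous endomorphism with OPEN image (the level-collapsing vertex
  homomorphisms of the locally open fold of file 2);
* `GaloisLevelData.tendsto_of_forall_eventually_proj_eq` — a sequence of `π₁^temp = lim_n Gal(𝒢_{∞,n}/𝒢)` whose
  level components are eventually those of `g` converges to `g` (generic);
* `escape_image_eq_conj_of_tail_trivial` — for a continuous endomorphism `φ` of `π₁^temp(𝒢⋆(p))` whose values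
  on the leaf translations `m_n` are trivial at the levels `j ≤ n` ("tail-trivial"), the images `φ(h_k)` of the
  divergent conjugators CONVERGE, so that `φ(c) = h·φ(ψ₀(a))·h⁻¹`: the image of the escaping element is
  conjugate to the image of `ψ₀(a)`;
* `not_isQuasiGeometric_of_apply_escape_mem_verticial` — **a continuous endomorphism `φ` of `π₁^temp(𝒢⋆(p))`
  with `φ(c) ≠ 1` inside a VERTICIAL subgroup is NOT quasi-geometric** (Def. 3.8): `φ(C₀)` would be an open
  subgroup of a maximal compact `K₂ ∋ φ(c)`, anchored hence verticial (abc-iut-w6-d064 at the star), i.e. a copy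
  of the SLIM group `F̂₂⁽ᵖ⁾` or `Leaf_m` (Thm. 3.7 (i)/(ii)), whose abelian open subgroups are trivial — yet the
  pull-back of the abelian `φ(C₀)` is one and contains the preimage of `φ(c) ≠ 1`.

Honest framing: OUR typed tempered group of OUR countable carrier `𝒢⋆(p)`; print's Cor. 3.9 (finite dual graphs in
every IUT use) untouched; nothing here bears on [IUTchIII] Cor. 3.12; no side taken; typed ≠ proved.
-/

noncomputable section

open CategoryTheory Topology Multiplicative Filter

namespace Literature.AnabelianGeometry.SemiGraphs

open IwahoriWitness

universe u

/-! ### The scaling endomorphisms of the leaf groups -/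

namespace Iw

variable {p : ℕ} [hp : Fact p.Prime]

/-- **The scaling endomorphism `(z, u) ↦ (p^k·z, u)` of `Leaf n = ℤ_p ⋊ ⟨1+p^{n+1}⟩‾`**: a continuous
endomorphism (the action of the unit coordinate on translations is by multiplication, which commutes with the
scaling) with OPEN image `p^k ℤ_p ⋊ ⟨1+p^{n+1}⟩‾`. [cite: MochizukiSemiAnbd2006, Def 2.2(ii) p.24] -/
theorem exists_leafScaling (n k : ℕ) :
    ∃ f : Leaf (p := p) n →ₜ* Leaf (p := p) n,
      (∀ x : Leaf (p := p) n, ((f x : Leaf (p := p) n) : Iw p) = ⟨(p : ℤ_[p]) ^ k * (x : Iw p).a, (x : Iw p).s⟩) ∧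
      IsOpen ((f.toMonoidHom.range : Subgroup (Leaf (p := p) n)) : Set (Leaf (p := p) n)) := by
  let f : Leaf (p := p) n →ₜ* Leaf (p := p) n :=
    { toFun := fun x => ⟨⟨(p : ℤ_[p]) ^ k * (x : Iw p).a, (x : Iw p).s⟩,
        (mem_leaf_iff n _).2 ((mem_leaf_iff n _).1 x.2)⟩
      map_one' := by ext <;> simp
      map_mul' := fun x y => by
        ext
        · change (p : ℤ_[p]) ^ k * ((x : Iw p) * (y : Iw p)).a =
            (p : ℤ_[p]) ^ k * (x : Iw p).a + w p (x : Iw p).s * ((p : ℤ_[p]) ^ k * (y : Iw p).a)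
          rw [mul_a]
          ring
        · rfl
      continuous_toFun := by
        apply Continuous.subtype_mk
        exact (continuous_mk_iff (p := p)).2 ⟨continuous_const.mul (continuous_a.comp continuous_subtype_val),
          continuous_s.comp continuous_subtype_val⟩ }
  have hf : ∀ x : Leaf (p := p) n, ((f x : Leaf (p := p) n) : Iw p) = ⟨(p : ℤ_[p]) ^ k * (x : Iw p).a, (x : Iw p).s⟩ :=
    fun _ => rfl
  refine ⟨f, hf, ?_⟩
  -- the image is `{y : ‖y.a‖ ≤ p^{-k}}`, the preimage of a closed ball of the ultrametric `ℤ_p` — open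
  have hball : IsOpen {z : ℤ_[p] | ‖z‖ ≤ (p : ℝ) ^ (-(k : ℤ))} := by
    have h : {z : ℤ_[p] | ‖z‖ ≤ (p : ℝ) ^ (-(k : ℤ))} = Metric.closedBall (0 : ℤ_[p]) ((p : ℝ) ^ (-(k : ℤ))) := by
      ext z; simp
    rw [h]
    exact IsUltrametricDist.isOpen_closedBall 0 (zpow_ne_zero _ (by exact_mod_cast hp.out.ne_zero))
  have heq : ((f.toMonoidHom.range : Subgroup (Leaf (p := p) n)) : Set (Leaf (p := p) n)) =
      (fun y : Leaf (p := p) n => (y : Iw p).a) ⁻¹' {z : ℤ_[p] | ‖z‖ ≤ (p : ℝ) ^ (-(k : ℤ))} := by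
    ext y
    constructor
    · rintro ⟨x, rfl⟩
      change ‖((f x : Leaf (p := p) n) : Iw p).a‖ ≤ _
      rw [hf x]
      change ‖(p : ℤ_[p]) ^ k * (x : Iw p).a‖ ≤ _
      rw [norm_mul, norm_pow, PadicInt.norm_p, inv_pow, ← zpow_natCast, ← zpow_neg]
      exact mul_le_of_le_one_right (zpow_nonneg (by positivity) _) (PadicInt.norm_le_one _)
    · intro hy
      change ‖(y : Iw p).a‖ ≤ (p : ℝ) ^ (-(k : ℤ)) at hy
      rw [PadicInt.norm_le_pow_iff_mem_span_pow, Ideal.mem_span_singleton'] at hy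
      obtain ⟨z, hz⟩ := hy
      refine ⟨⟨⟨z, (y : Iw p).s⟩, (mem_leaf_iff n _).2 ((mem_leaf_iff n _).1 y.2)⟩, ?_⟩
      change f _ = y
      ext
      · change (p : ℤ_[p]) ^ k * z = (y : Iw p).a
        rw [← hz, mul_comm]
      · rfl
  rw [heq]
  exact hball.preimage (continuous_a.comp continuous_subtype_val)

end Iw

namespace ProfiniteSemiGraph

/-! ### Convergence in `π₁^temp = lim_n Gal(𝒢_{∞,n}/𝒢)` from eventually constant level components -/

/-- **A sequence in `π₁^temp(𝒢)` whose level-`n` components are eventually those of `g`, for every `n`, converges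
to `g`** (the topology is induced from the product of the discrete level groups).
[cite: MochizukiSemiAnbd2006, Prop 3.6(i) p.38] -/
theorem GaloisLevelData.tendsto_of_forall_eventually_proj_eq {𝒢 : ProfiniteSemiGraph.{u}} (D : GaloisLevelData 𝒢)
    (h𝒢 : 𝒢.IsCountable) (z : ℕ → D.temperedPi h𝒢) (g : D.temperedPi h𝒢)
    (hz : ∀ n, ∃ N, ∀ k, N ≤ k → D.proj h𝒢 n (z k) = D.proj h𝒢 n g) :
    Tendsto z atTop (𝓝 g) := by
  refine (tendsto_subtype_rng (p := fun x : (∀ i, (D.system h𝒢).obj i) => x ∈ (D.system h𝒢).limit)).mpr ?_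
  refine tendsto_pi_nhds.mpr fun i => ?_
  obtain ⟨N, hN⟩ := hz i.down
  rw [nhds_discrete, tendsto_pure, eventually_atTop]
  exact ⟨N, fun k hk => hN k hk⟩

variable {p : ℕ} [hp : Fact p.Prime] {h36 : (metabelianLeafStar p).Prop36Hypotheses}
  (P₀ : ((metabelianLeafStar p).galoisLevelData h36).PointSeq h36.isCountable (leafStarCentre p))

/-! ### Tail-trivial endomorphisms conjugate the escaping element into the image of the centre -/

/-- **`φ(c) = h·φ(ψ₀(a))·h⁻¹` for a TAIL-TRIVIAL continuous endomorphism `φ`** of `π₁^temp(𝒢⋆(p))` (one with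
`ρ_j(φ(m_n)) = 1` for all `j ≤ n`, `m_n` the unit translation of the leaf `n` read in `π₁^temp`): the images
`φ(h_k)` of the divergent conjugators `h_k = m_0⋯m_k` have eventually constant level components, hence converge
(completeness) to some `h`, and `φ(c) = lim φ(h_k ψ₀(a) h_k⁻¹) = h·φ(ψ₀(a))·h⁻¹`.
[cite: MochizukiSemiAnbd2006, Prop 3.6(iv) p.39] -/
theorem escape_image_eq_conj_of_tail_trivial
    (c : ((metabelianLeafStar p).galoisLevelData h36).temperedPi h36.isCountable) (N : ℕ → ℕ)
    (hcN : ∀ j k, N j ≤ k → ((metabelianLeafStar p).galoisLevelData h36).proj h36.isCountable j c =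
      ((metabelianLeafStar p).galoisLevelData h36).proj h36.isCountable j (escC P₀ k))
    (φ : ((metabelianLeafStar p).temperedPiChart h36).G →ₜ* ((metabelianLeafStar p).temperedPiChart h36).G)
    (htail : ∀ j n, j ≤ n →
      ((metabelianLeafStar p).galoisLevelData h36).proj h36.isCountable j (φ (escM P₀ n)) = 1) :
    ∃ h : ((metabelianLeafStar p).temperedPiChart h36).G, φ c = h * φ (escY P₀) * h⁻¹ := by
  let Dg := (metabelianLeafStar p).galoisLevelData h36
  have hc := h36.isCountable
  haveI : T2Space (Dg.temperedPi hc) := Dg.t2Space_temperedPi hc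
  -- `φ` read on the tower's group (the chart's group, definitionally)
  let φ₁ : Dg.temperedPi hc →* Dg.temperedPi hc := φ.toMonoidHom
  have hφ₁ : Continuous φ₁ := φ.continuous
  have hφ₁_apply : ∀ x, φ₁ x = φ x := fun _ => rfl
  -- the images of the conjugators have eventually constant level components
  let w : ℕ → Dg.temperedPi hc := fun k => φ₁ (escH P₀ k)
  have hw : ∀ j, ∃ N', ∀ k, N' ≤ k → Dg.projAut hc j (w (k + 1)) = Dg.projAut hc j (w k) := by
    intro j
    refine ⟨j, fun k hk => ?_⟩
    change Dg.proj hc j (φ₁ (escH P₀ (k + 1))) = Dg.proj hc j (φ₁ (escH P₀ k))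
    rw [escH_succ, map_mul, map_mul, hφ₁_apply (escM P₀ (k + 1)), htail j (k + 1) (by omega), mul_one]
  obtain ⟨h, hh⟩ := Dg.exists_forall_eventually_projAut_eq hc w hw
  refine ⟨h, ?_⟩
  -- `φ(h_k) → h`, `c_k → c`, `φ(c_k) → φ(c)` and `φ(c_k) = φ(h_k) φ(y) φ(h_k)⁻¹ → h φ(y) h⁻¹`
  have hwt : Tendsto w atTop (𝓝 h) := by
    refine Dg.tendsto_of_forall_eventually_proj_eq hc w h fun n => ?_
    obtain ⟨N', hN'⟩ := hh n
    exact ⟨N', fun k hk => (hN' k hk).symm⟩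
  have hct : Tendsto (escC P₀) atTop (𝓝 c) :=
    Dg.tendsto_of_forall_eventually_proj_eq hc (escC P₀) c fun n => ⟨N n, fun k hk => (hcN n k hk).symm⟩
  have hφct : Tendsto (fun k => φ₁ (escC P₀ k)) atTop (𝓝 (φ₁ c)) := (hφ₁.tendsto c).comp hct
  have hprod : Tendsto (fun k => w k * φ₁ (escY P₀) * (w k)⁻¹) atTop (𝓝 (h * φ₁ (escY P₀) * h⁻¹)) :=
    (hwt.mul tendsto_const_nhds).mul hwt.inv
  have heq : (fun k => φ₁ (escC P₀ k)) = fun k => w k * φ₁ (escY P₀) * (w k)⁻¹ := by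
    funext k
    change φ₁ (escH P₀ k * escY P₀ * (escH P₀ k)⁻¹) = φ₁ (escH P₀ k) * φ₁ (escY P₀) * (φ₁ (escH P₀ k))⁻¹
    rw [map_mul, map_mul, map_inv]
  rw [heq] at hφct
  have key : φ₁ c = h * φ₁ (escY P₀) * h⁻¹ := tendsto_nhds_unique hφct hprod
  exact key

/-! ### An anchored image of the escaping compact kills quasi-geometricity -/

/-- **A continuous endomorphism `φ` of `π₁^temp(𝒢⋆(p))` with `φ(c) ≠ 1` in a verticial subgroup is not
quasi-geometric** (Def. 3.8, first clause, at the ABELIAN exotic maximal compact `C₀ = ⟨c⟩‾` of gen 7's B2): a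
maximal compact `K₂ ⊇ φ(C₀)` contains `φ(c)`, is anchored, hence verticial (abc-iut-w6-d064), the image of an
injective verticial homomorphism `ψ` from the SLIM group `F̂₂⁽ᵖ⁾` or `Leaf_m` (Thm. 3.7 (i)/(ii)); the pull-back
of `φ(C₀)` along `ψ` would be an abelian OPEN subgroup, trivial by slimness, yet containing `ψ⁻¹(φ(c)) ≠ 1`.
[cite: MochizukiSemiAnbd2006, Def 3.8 p.42] -/
theorem not_isQuasiGeometric_of_apply_escape_mem_verticial
    (c : ((metabelianLeafStar p).galoisLevelData h36).temperedPi h36.isCountable) (N : ℕ → ℕ)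
    (hcN : ∀ j k, N j ≤ k → ((metabelianLeafStar p).galoisLevelData h36).proj h36.isCountable j c =
      ((metabelianLeafStar p).galoisLevelData h36).proj h36.isCountable j (escC P₀ k))
    (hC : IsCompact ((Subgroup.zpowers c).topologicalClosure :
      Set (((metabelianLeafStar p).galoisLevelData h36).temperedPi h36.isCountable)))
    (hact : ∀ j k, N j ≤ k → ((metabelianLeafStar p).galoisLevelData h36).treeAct h36.isCountable j c =
      ((metabelianLeafStar p).galoisLevelData h36).treeAct h36.isCountable j (escC P₀ k))
    (φ : ((metabelianLeafStar p).temperedPiChart h36).G →ₜ* ((metabelianLeafStar p).temperedPiChart h36).G)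
    {v : (metabelianLeafStar p).graph.Vertex} {V : Subgroup ((metabelianLeafStar p).temperedPiChart h36).G}
    (hV : V ∈ verticialSubgroups ((metabelianLeafStar p).temperedPiChart h36) v) (hcV : φ c ∈ V)
    (hc1 : φ c ≠ 1) : ¬ IsQuasiGeometric φ := by
  intro hq
  obtain ⟨hmax, hno⟩ := escape_isMaximalCompactSubgroup P₀ c N hcN hC hact
  -- `C₀` read as a subgroup of the chart's group (the tower's group, definitionally)
  let C₀ : Subgroup ((metabelianLeafStar p).temperedPiChart h36).G := (Subgroup.zpowers c).topologicalClosure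
  have hcC : c ∈ C₀ := Subgroup.le_topologicalClosure _ (Subgroup.mem_zpowers _)
  obtain ⟨K₂, hK₂, hle, hopen⟩ := hq.maximal C₀ hmax
  have hcK₂ : φ c ∈ K₂ := hle (Subgroup.mem_map_of_mem φ.toMonoidHom hcC)
  -- `K₂` is anchored by `V`, hence verticial: the range of an injective verticial homomorphism `ψ : Π_w → π₁^temp`
  have hanch : K₂ ⊓ V ≠ ⊥ := fun h =>
    hc1 ((Subgroup.eq_bot_iff_forall _).mp h _ (Subgroup.mem_inf.mpr ⟨hcK₂, hcV⟩))
  obtain ⟨w, ψ, hψ, hK₂eq⟩ := metabelianLeafStar_exists_mem_verticialSubgroups_of_isMaximalCompactSubgroup p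
    ((metabelianLeafStar p).temperedPiChart h36) K₂ hK₂ hV hanch
  subst hK₂eq
  have hinj : Function.Injective ψ :=
    (verticialInjective_holds _ (metabelianLeafStar_thm37Hypotheses' p) ((metabelianLeafStar p).temperedPiChart h36)
      w).2 ψ hψ
  -- `C₀` is commutative (abc-iut-w6-d064's dichotomy; it lies in no verticial subgroup)
  have hcomm : ∀ x ∈ C₀, ∀ y ∈ C₀, x * y = y * x := by
    rcases metabelianLeafStar_le_verticial_or_commutative p ((metabelianLeafStar p).temperedPiChart h36) C₀ hC
      with ⟨v', H, hH, hle'⟩ | h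
    · exact absurd hle' (hno v' H hH)
    · exact h
  -- the pull-back `A := ψ⁻¹(φ(C₀))`: an open, abelian subgroup of `Π_w`
  let A : Subgroup ((metabelianLeafStar p).Gv w) := (C₀.map φ.toMonoidHom).comap ψ.toMonoidHom
  have hA : IsOpen (A : Set ((metabelianLeafStar p).Gv w)) := by
    have hcont : Continuous ψ.toMonoidHom.rangeRestrict := continuous_induced_rng.2 ψ.continuous
    exact hopen.preimage hcont
  have hAcomm : ∀ x ∈ A, ∀ y ∈ A, x * y = y * x := by
    intro x hx y hy
    obtain ⟨x', hx', hxe⟩ := Subgroup.mem_map.mp hx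
    obtain ⟨y', hy', hye⟩ := Subgroup.mem_map.mp hy
    apply hinj
    rw [map_mul, map_mul]
    change φ.toMonoidHom x' = ψ x at hxe
    change φ.toMonoidHom y' = ψ y at hye
    rw [← hxe, ← hye, ← map_mul, ← map_mul, hcomm x' hx' y' hy']
  -- slimness of `Π_w` (`F̂₂⁽ᵖ⁾` at the centre, `Leaf_m` at a leaf): `Z(A) = 1`
  have hbot : Subgroup.centralizer (A : Set ((metabelianLeafStar p).Gv w)) = ⊥ := by
    cases w with
    | none => exact (FreeProPRankTwo.isSlimGroup p).centralizer_eq_bot A hA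
    | some m => exact (Iw.isSlimGroup_leaf m).centralizer_eq_bot A hA
  -- but `ψ⁻¹(φ(c)) ∈ A` is central in the abelian `A` and non-trivial
  obtain ⟨x₀, hx₀⟩ : ∃ x₀, ψ x₀ = φ c := hcK₂
  have hx₀A : x₀ ∈ A := by
    change ψ.toMonoidHom x₀ ∈ C₀.map φ.toMonoidHom
    rw [show ψ.toMonoidHom x₀ = φ c from hx₀]
    exact Subgroup.mem_map_of_mem φ.toMonoidHom hcC
  have hx₀c : x₀ ∈ Subgroup.centralizer (A : Set ((metabelianLeafStar p).Gv w)) := by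
    rw [Subgroup.mem_centralizer_iff]
    exact fun y hy => hAcomm y hy x₀ hx₀A
  rw [hbot] at hx₀c
  apply hc1
  rw [← hx₀, Subgroup.mem_bot.mp hx₀c, map_one]

end ProfiniteSemiGraph

end Literature.AnabelianGeometry.SemiGraphs

end
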